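import Summits.BirchSwinnertonDyer.BirchSwinnertonDyer.Theorems.ThetaPartnerAtTwoSignedMainConjectureCMTwoRankZeroPTDeepAssembly
import Literature.NumberTheory.EllipticCurves.Kato2004.IntegralH1Corestriction
import Literature.NumberTheory.EllipticCurves.SelmerGroupOverTorsionFinite
import Literature.NumberTheory.EllipticCurves.ZpExtensionUnramifiedProofs
import Literature.NumberTheory.EllipticCurves.GaloisActionProofs
import HarnessLib

/-!
# Route `ThetaPartnerAtTwo` (TP2), crux K2R0P♭ `SignedMainConjectureCMTwoRankZeroOfPubOfFlat` (stmt-BirchSwinnertonDyer-26471;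
# derived node K2r0P stmt-BirchSwinnertonDyer-24945), line `rankzero` v20, stub `stub_poitouTateDeepTwo` = (S_PT) — hypothesis (R) of the
# assembly `SignedLowerOffTwo.PTDeep.poitouTateDeep_of_levelwise` (brick B9), DISCHARGED for the ADMISSIBLE SETS «classes of `H¹(Γ_n, W[p^k])`
# unramified outside a finite set `S ∋ p` of places» along ANY `ℤ_p`-extension: FINITE (Silverman X.4.3 at level `Γ_n`), stable under `p_*`,
# stable under the trace maps (Kato §8.2 functoriality of `H¹(O_F[S⁻¹], ·)` for `Cor`, normal level unramified outside `S`); and the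
# (I)-ingredient «`T_pW`-adic classes all of whose reductions are unramified at `𝔓` are unramified at `𝔓`»

HONEST FRAMING (cell `pub/bsd-wall`, W-ALL row 1; lead prover `bsd-wall-tp2-p2` g10, `--supports` only). THEOREMS ONLY (no definition,
no named fact, no instance, no `sorry`); closes no item; BSD is NOT proved by any of this.

## What is here

The admissible set at `(n, k)` is written in place (no definition):
`{c : H¹(Γ_n, W[p^k]) | ∀ v ∉ S, ∀ 𝔓 ∣ v, resLe (W.torsionGaloisModule (p^k)).toTopRep (inf_le_left : Γ_n ⊓ I_𝔓 ≤ Γ_n) 1 c = 0}`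
(`Γ_n = κ.layerSubgroup n`; the shape of `Kato2004.integralH1` with `{p}` replaced by `S`).
* `coresLe_resLe_inertia_eq_zero` — GENERIC (any `GaloisRep ℚ A M`, any normal open `V ≤ U` of finite index, any place `v` with `I_𝔓 ≤ V` for
  all `𝔓 ∣ v`): if `x ∈ H¹(V, T)` dies on every `V ⊓ I_𝔓`, `𝔓 ∣ v`, then `Cor x` dies on every `U ⊓ I_𝔓`, `𝔓 ∣ v` (the per-place form of the
  tree's `Kato2004.coresLe_mem_integralH1`, same cocycle proof: NSW (1.5.7) in the normal case).
* `admissible_layerCores` — stability under `Kato2004.layerCores` along any `ℤ_p`-extension `κ` of `ℚ` for `p ∈ S` (the layers are unramified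
  outside `p`: `ZpExtension.inertia_le_kerSubgroup_holds`, Washington Prop. 13.2).
* `admissible_reduceTorsionH1` — stability under `p_*` (`Kato2004.reduceTorsionH1_resLe`).
* `admissible_finite` — FINITENESS for finite `S` (the tree's Lemma X.4.3 at level `H`, `finite_setOf_resOfLe_inertia_inf_eq_zero`, read through
  the cocycle criterion: `resOfLe` on `I_𝔓 ⊓ Γ_n` and `resLe` on `Γ_n ⊓ I_𝔓` vanish together).
* `resLe_inertia_eq_zero_of_forall_reduceH1Pk` — (I) at the places outside `S`: a class `y ∈ H¹(Γ_n, T_pW)` all of whose reductions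
  `red_{p^k} y` die on `Γ_n ⊓ I_𝔓` dies there itself (`reduceH1Pk_resLe` + separatedness `eq_zero_of_forall_reduceH1Pk_eq_zero` on `Γ_n ⊓ I_𝔓`).

References: [SilvermanAEC2009] Lemma X.4.3; [Kato2004Asterisque] §8.2, Lemma 8.5 (pp. 180–184); [NeukirchSchmidtWingberg2008] I §5 (1.5.7);
[Washington1997] Prop. 13.2; [Rubin2000] App. B Prop. B.2.3.
-/

set_option autoImplicit false
-- the Theorems namespace of this sub repeats the summit name by design (D-0017 nested layout)
set_option linter.dupNamespace false

noncomputable section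

open scoped Classical Pointwise

namespace Summit.BirchSwinnertonDyer.BirchSwinnertonDyer.Theorems

namespace SignedLowerOffTwo.PTDeep

open CategoryTheory NumberField IsDedekindDomain Field WeierstrassCurve
  Literature.NumberTheory.EllipticCurves Literature.NumberTheory.GaloisRepresentations
  Literature.NumberTheory.EllipticCurves.Kato2004 Literature.NumberTheory.EllipticCurves.Kato2004.EulerSystemValues ZpExtension
  Rat.HeightOneSpectrum

/-! ## §1 Corestriction preserves «dies on every inertia group above `v`» (per place; NSW (1.5.7), normal case) -/

section Cores

variable {A : Type} [CommRing A] [TopologicalSpace A] {M : Type} [AddCommGroup M] [Module A M]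
  [TopologicalSpace M] [IsTopologicalAddGroup M] [ContinuousSMul A M]

/-- For `N` normal, elements of `N` act trivially on `U/N`. [folklore] -/
private theorem smul_quotient_eq_self_of_mem {G : Type*} [Group G] {N U : Subgroup G} [N.Normal] {n : U}
    (hn : (n : G) ∈ N) (x : U ⧸ N.subgroupOf U) : n • x = x := by
  induction x using QuotientGroup.induction_on with
  | H u =>
    rw [MulAction.Quotient.smul_mk, QuotientGroup.eq, Subgroup.mem_subgroupOf, smul_eq_mul]
    have : (((n * u)⁻¹ * u : U) : G) = (u : G)⁻¹ * (n : G)⁻¹ * ((u : G)⁻¹)⁻¹ := by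
      push_cast; group
    rw [this]
    exact Subgroup.Normal.conj_mem inferInstance _ (N.inv_mem hn) _

/-- **`Cor_{V→U}` preserves «dies on every `I_𝔓`, `𝔓 ∣ v`», place by place** (the per-place form of `Kato2004.coresLe_mem_integralH1`):
`V ⊴ Γ_ℚ` normal, open, of finite index in `U ≥ V`, containing every `I_𝔓`, `𝔓 ∣ v`; if `x ∈ H¹(V, T)` restricts to `0` on every
`V ⊓ I_𝔓` (`𝔓 ∣ v`) then `Cor x` restricts to `0` on every `U ⊓ I_𝔓` (`𝔓 ∣ v`).  On cocycles: for `y ∈ U ∩ I_𝔓 ⊆ V`,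
`(cor_s φ)(y) = Σ_x s(x)·φ(s(x)⁻¹ y s(x))` with `s(x)⁻¹ y s(x) ∈ V ∩ I_{s(x)⁻¹𝔓}` where `φ` is a coboundary.
[cite: Kato2004Asterisque, §8.2 and Lemma 8.5 (pp. 180–184)] [cite: NeukirchSchmidtWingberg2008, I §5 (1.5.7)] -/
theorem coresLe_resLe_inertia_eq_zero (T : GaloisRep ℚ A M)
    {V U : Subgroup (absoluteGaloisGroup ℚ)} [V.Normal] (h : V ≤ U)
    (hV : IsOpen (V : Set (absoluteGaloisGroup ℚ))) [Fintype (U ⧸ V.subgroupOf U)]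
    (v : HeightOneSpectrum (𝓞 ℚ)) (hunr : SubgroupIsUnramifiedAt ℚ V v)
    {x : H1 T V} (hx : ∀ 𝔓 ∈ v.primesAbove,
      resLe T.toTopRep (inf_le_left : V ⊓ 𝔓.inertia (absoluteGaloisGroup ℚ) ≤ V) 1 x = 0)
    (𝔓 : Ideal (absIntegers (𝓞 ℚ) ℚ)) (h𝔓 : 𝔓 ∈ v.primesAbove) :
    resLe T.toTopRep (inf_le_left : U ⊓ 𝔓.inertia (absoluteGaloisGroup ℚ) ≤ U) 1 (coresLe T.toTopRep h hV x) = 0 := by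
  obtain ⟨φ, rfl⟩ := oneCocycleClass_surjective _ x
  -- representatives of `U/V`
  have hs : ∀ y : U ⧸ V.subgroupOf U, ((Quotient.out y : U) : U ⧸ V.subgroupOf U) = y :=
    fun y ↦ QuotientGroup.out_eq' y
  -- `φ` is a coboundary on `V ∩ I_{𝔓'}` for every `𝔓' ∣ v`: choose the witnesses at the conjugates
  have hcob : ∀ y : U ⧸ V.subgroupOf U, ∃ w : M,
      ∀ g : ↥(V ⊓ ((((Quotient.out y : U) : absoluteGaloisGroup ℚ)⁻¹ • 𝔓).inertia
        (absoluteGaloisGroup ℚ))),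
      φ.1 (subgroupInclusion inf_le_left g) = T.toTopRep.ρ (g : absoluteGaloisGroup ℚ) w - w := by
    intro y
    have h0 := hx _ (smul_mem_primesAbove h𝔓 ((Quotient.out y : U) : absoluteGaloisGroup ℚ)⁻¹)
    rw [resLe_oneCocycleClass, oneCocycleClass_eq_zero_iff] at h0
    obtain ⟨w, hw⟩ := h0
    exact ⟨w, fun g ↦ hw g⟩
  choose w hw using hcob
  rw [coresLe_oneCocycleClass T.toTopRep h hV hs φ, resLe_oneCocycleClass, oneCocycleClass_eq_zero_iff]
  refine ⟨∑ y, T.toTopRep.ρ ((Quotient.out y : U) : absoluteGaloisGroup ℚ) (w y), fun g ↦ ?_⟩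
  -- `g ∈ U ∩ I_𝔓`, hence `g ∈ V` (unramified) and it acts trivially on `U/V`
  have hgI : (g : absoluteGaloisGroup ℚ) ∈ 𝔓.inertia (absoluteGaloisGroup ℚ) := g.2.2
  have hgV : (g : absoluteGaloisGroup ℚ) ∈ V := hunr 𝔓 h𝔓 hgI
  rw [contOneCocycles.pullback_apply, TopRep.hom_ofHom]
  change (transferCocycle (subgroupRep T.toTopRep U) (V.subgroupOf U) (isOpen_subgroupOf U hV) hs
      (contOneCocycles.pullback (subgroupOfHom h)
        (Y := subgroupRep (subgroupRep T.toTopRep U) (V.subgroupOf U))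
        (TopRep.ofHom ⟨ContinuousLinearMap.id A M, fun _ => rfl⟩) φ)).1
      (subgroupInclusion (inf_le_left : U ⊓ 𝔓.inertia (absoluteGaloisGroup ℚ) ≤ U) g) = _
  rw [transferCocycle_pullback_apply T.toTopRep h hV hs, map_sum, ← Finset.sum_sub_distrib]
  refine Finset.sum_congr rfl fun y _ ↦ ?_
  have hgy : subgroupInclusion (inf_le_left : U ⊓ 𝔓.inertia (absoluteGaloisGroup ℚ) ≤ U) g • y = y :=
    smul_quotient_eq_self_of_mem (by simpa [subgroupInclusion_apply_coe] using hgV) y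
  -- the Schreier element `s(y)⁻¹ g s(y)` lies in `V ∩ I_{s(y)⁻¹ 𝔓}`
  set σ : absoluteGaloisGroup ℚ := ((Quotient.out y : U) : absoluteGaloisGroup ℚ) with hσ
  have hmemI : σ⁻¹ * (g : absoluteGaloisGroup ℚ) * σ ∈ (σ⁻¹ • 𝔓).inertia (absoluteGaloisGroup ℚ) := by
    have := (Ideal.conj_mem_inertia_smul_iff 𝔓 σ⁻¹ (g : absoluteGaloisGroup ℚ)).mpr hgI
    simpa using this
  have hmemV : σ⁻¹ * (g : absoluteGaloisGroup ℚ) * σ ∈ V :=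
    Subgroup.Normal.conj_mem' inferInstance _ hgV σ
  have key := hw y ⟨σ⁻¹ * (g : absoluteGaloisGroup ℚ) * σ, hmemV, hmemI⟩
  -- identify the argument of `φ`
  have harg : subgroupOfHom h (schreierElt (V.subgroupOf U) hs
        (subgroupInclusion (inf_le_left : U ⊓ 𝔓.inertia (absoluteGaloisGroup ℚ) ≤ U) g) y) =
      subgroupInclusion inf_le_left ⟨σ⁻¹ * (g : absoluteGaloisGroup ℚ) * σ, hmemV, hmemI⟩ := by
    apply Subtype.ext
    rw [subgroupOfHom_apply_coe, schreierElt_coe, hgy, subgroupInclusion_apply_coe]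
    simp [hσ, subgroupInclusion_apply_coe]
  have key' : φ.1 (subgroupInclusion inf_le_left ⟨σ⁻¹ * (g : absoluteGaloisGroup ℚ) * σ, hmemV, hmemI⟩) =
      T.toTopRep.ρ (σ⁻¹ * (g : absoluteGaloisGroup ℚ) * σ) (w y) - w y := key
  rw [hgy, harg, key', map_sub, subgroupRep_ρ_apply, ← ρ_mul_apply, ← ρ_mul_apply, ← hσ]
  have hprod : σ * (σ⁻¹ * (g : absoluteGaloisGroup ℚ) * σ) = (g : absoluteGaloisGroup ℚ) * σ := by
    group
  rw [hprod]

end Cores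

/-! ## §2 The admissible sets along a `ℤ_p`-extension: stability under the trace maps and under `p_*` -/

variable (W : WeierstrassCurve ℚ) [W.IsElliptic] {p : ℕ} [Fact p.Prime] (κ : ZpExtension ℚ p)

omit [W.IsElliptic] in
/-- The layers `Γ_n` of ANY `ℤ_p`-extension of `ℚ` contain the inertia groups of all primes `𝔓 ∤ p` (a `ℤ_p`-extension is unramified
outside `p`: the tree's theorem `ZpExtension.inertia_le_kerSubgroup_holds`, Washington Prop. 13.2; and `Γ_∞ ≤ Γ_n`).
[cite: Washington1997, Prop. 13.2] -/
theorem subgroupIsUnramifiedAt_layerSubgroup (n : ℕ) {v : HeightOneSpectrum (𝓞 ℚ)} (hv : (p : 𝓞 ℚ) ∉ v.asIdeal) :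
    SubgroupIsUnramifiedAt ℚ (κ.layerSubgroup n) v := fun _ h𝔓 ↦
  (ZpExtension.inertia_le_kerSubgroup_holds ℚ p κ hv h𝔓).trans (κ.kerSubgroup_le_layerSubgroup n)

omit [W.IsElliptic] in
/-- **Stability of the admissible sets under the trace maps** `Cor : H¹(Γ_{n+1}, W[q]) → H¹(Γ_n, W[q])` (`Kato2004.layerCores`):
a class dying on every `Γ_{n+1} ⊓ I_𝔓`, `𝔓 ∣ v ∉ S`, has trace dying on every `Γ_n ⊓ I_𝔓`, `𝔓 ∣ v ∉ S` — provided `S` contains the place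
`p` (so that the layers are unramified outside `S`). [cite: Kato2004Asterisque, §8.2 (p. 181) and §12.2 (p. 220)]
[cite: NeukirchSchmidtWingberg2008, I §5 (1.5.7)] -/
theorem admissible_layerCores (q : ℤ) {S : Set (HeightOneSpectrum (𝓞 ℚ))}
    (hS : ∀ v : HeightOneSpectrum (𝓞 ℚ), (p : 𝓞 ℚ) ∈ v.asIdeal → v ∈ S) (n : ℕ)
    {c : W.torsionH1Over q (κ.layerSubgroup (n + 1))}
    (hc : ∀ v ∉ S, ∀ 𝔓 ∈ v.primesAbove,
      resLe (W.torsionGaloisModule q).toTopRep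
        (inf_le_left : κ.layerSubgroup (n + 1) ⊓ 𝔓.inertia (absoluteGaloisGroup ℚ) ≤ κ.layerSubgroup (n + 1)) 1 c = 0) :
    ∀ v ∉ S, ∀ 𝔓 ∈ v.primesAbove,
      resLe (W.torsionGaloisModule q).toTopRep
        (inf_le_left : κ.layerSubgroup n ⊓ 𝔓.inertia (absoluteGaloisGroup ℚ) ≤ κ.layerSubgroup n) 1
        (layerCores (W.torsionGaloisModule q) κ n c) = 0 := by
  intro v hv 𝔓 h𝔓
  have hpv : (p : 𝓞 ℚ) ∉ v.asIdeal := fun h ↦ hv (hS v h)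
  haveI : (κ.layerSubgroup (n + 1)).FiniteIndex := finiteIndex_of_isOpen_of_compactSpace _ (κ.isOpen_layerSubgroup (n + 1))
  letI : Fintype (κ.layerSubgroup n ⧸ (κ.layerSubgroup (n + 1)).subgroupOf (κ.layerSubgroup n)) := Fintype.ofFinite _
  unfold layerCores
  exact coresLe_resLe_inertia_eq_zero (W.torsionGaloisModule q) (κ.layerSubgroup_antitone (Nat.le_succ n))
    (κ.isOpen_layerSubgroup (n + 1)) v (subgroupIsUnramifiedAt_layerSubgroup κ (n + 1) hpv) (hc v hv) 𝔓 h𝔓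

omit [W.IsElliptic] [Fact p.Prime] in
/-- **Stability of the admissible sets under `p_*`** (`WeierstrassCurve.reduceTorsionH1` commutes with restriction,
`Kato2004.reduceTorsionH1_resLe`). [cite: PerrinRiou1987BSMF, §0 (p. 401)] [cite: SerreGaloisCohomology1997, I §2.4] -/
theorem admissible_reduceTorsionH1 (k : ℕ) {S : Set (HeightOneSpectrum (𝓞 ℚ))} (U : Subgroup (absoluteGaloisGroup ℚ))
    {c : W.torsionH1Over ((p : ℤ) ^ (k + 1)) U}
    (hc : ∀ v ∉ S, ∀ 𝔓 ∈ v.primesAbove,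
      resLe (W.torsionGaloisModule ((p : ℤ) ^ (k + 1))).toTopRep
        (inf_le_left : U ⊓ 𝔓.inertia (absoluteGaloisGroup ℚ) ≤ U) 1 c = 0) :
    ∀ v ∉ S, ∀ 𝔓 ∈ v.primesAbove,
      resLe (W.torsionGaloisModule ((p : ℤ) ^ k)).toTopRep (inf_le_left : U ⊓ 𝔓.inertia (absoluteGaloisGroup ℚ) ≤ U) 1
        (W.reduceTorsionH1 p k U c) = 0 := by
  intro v hv 𝔓 h𝔓
  rw [← reduceTorsionH1_resLe, hc v hv 𝔓 h𝔓]
  exact (W.reduceTorsionH1 p k _).map_zero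

/-! ## §3 Finiteness of the admissible sets (Silverman X.4.3 at level `Γ_n`) -/

omit [W.IsElliptic] in
/-- `resLe` on `H ⊓ I` and the tree's `resOfLe` on `I ⊓ H` vanish together (both say: the cocycle is principal on `H ∩ I`).
[cite: SerreGaloisCohomology1997, I §5.1] -/
theorem resLe_inf_eq_zero_iff_resOfLe_inf_eq_zero (q : ℤ) (H I : Subgroup (absoluteGaloisGroup ℚ)) (c : W.torsionH1Over q H) :
    resLe (W.torsionGaloisModule q).toTopRep (inf_le_left : H ⊓ I ≤ H) 1 c = 0 ↔
      resOfLe (geomTorsion W q) (inf_le_right : I ⊓ H ≤ H) c = 0 := by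
  obtain ⟨φ, rfl⟩ := oneCocycleClass_surjective (subgroupRep (W.torsionGaloisModule q).toTopRep H) c
  rw [resLe_oneCocycleClass, oneCocycleClass_eq_zero_iff]
  have h2 := resOfLe_oneCocycleClass_eq_zero_iff H (M := geomTorsion W q) (inf_le_right : I ⊓ H ≤ H) φ
  change _ ↔ resOfLe (geomTorsion W q) (inf_le_right : I ⊓ H ≤ H)
    (oneCocycleClass (discreteTopRep H (geomTorsion W q)) φ) = 0
  rw [h2]
  constructor
  · rintro ⟨a, ha⟩
    exact ⟨a, fun σ ↦ ha ⟨σ.1, σ.2.2, σ.2.1⟩⟩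
  · rintro ⟨a, ha⟩
    exact ⟨a, fun σ ↦ ha ⟨σ.1, σ.2.2, σ.2.1⟩⟩

/-- **The admissible sets are FINITE** for finite `S`: the classes of `H¹(Γ_n, W[q])` (`q ≠ 0`) dying on every `Γ_n ⊓ I_𝔓`, `𝔓 ∣ v ∉ S`, form
a finite set — Silverman X.4.3 at the open level `Γ_n` (the tree's `finite_setOf_resOfLe_inertia_inf_eq_zero`: the cocycles inject into
`Hom(U, W[q]; S) × W[q]^{Γ_n/U}` for `U = Γ_n ∩ ker(Γ_ℚ → Aut W[q])`, and `Hom(U, ·; S)` is finite by AEC VIII.1.6). Any open `H ≤ Γ_ℚ`.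
[cite: SilvermanAEC2009, Lemma X.4.3 and Prop. VIII.1.6] -/
theorem admissible_finite {q : ℤ} (hq : q ≠ 0) {S : Set (HeightOneSpectrum (𝓞 ℚ))} (hS : S.Finite)
    (H : Subgroup (absoluteGaloisGroup ℚ)) (hH : IsOpen (H : Set (absoluteGaloisGroup ℚ))) :
    {c : W.torsionH1Over q H | ∀ v ∉ S, ∀ 𝔓 ∈ v.primesAbove,
      resLe (W.torsionGaloisModule q).toTopRep (inf_le_left : H ⊓ 𝔓.inertia (absoluteGaloisGroup ℚ) ≤ H) 1 c = 0}.Finite := by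
  haveI : Finite (geomTorsion W q) := W.finite_torsionPoints_holds (AlgebraicClosure ℚ) hq
  haveI : ContinuousSMul (absoluteGaloisGroup ℚ) (geomTorsion W q) :=
    W.continuousSMul_geomTorsion (isOpen_stabilizer_point_holds W) q
  refine (finite_setOf_resOfLe_inertia_inf_eq_zero H (M := geomTorsion W q) hH hS).subset fun c hc v hv 𝔓 h𝔓 ↦ ?_
  exact (resLe_inf_eq_zero_iff_resOfLe_inf_eq_zero W q H _ c).mp (hc v hv 𝔓 h𝔓)

/-! ## §4 (I) outside `S`: a `T_pW`-adic class all of whose reductions die on `Γ_n ⊓ I_𝔓` dies there -/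

variable [ContinuousSMul ℤ_[p] (W.tateModule p)]

/-- **Unramifiedness at `𝔓` is read on the reductions**: `y ∈ H¹(U, T_pW)` with `red_{p^k} y` dying on `U ⊓ I_𝔓` for every `k`
dies on `U ⊓ I_𝔓` (`reduceH1Pk_resLe` and the separatedness of `H¹(U ⊓ I_𝔓, T_pW)`, `Kato2004.eq_zero_of_forall_reduceH1Pk_eq_zero`).
[cite: Rubin2000, App. B Prop. B.2.3] [cite: Kato2004Asterisque, §8.2 (p. 180)] -/
theorem resLe_inertia_eq_zero_of_forall_reduceH1Pk (U I : Subgroup (absoluteGaloisGroup ℚ)) (y : H1 (tateRep W p) U)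
    (hy : ∀ k : ℕ, resLe (W.torsionGaloisModule ((p : ℤ) ^ k)).toTopRep (inf_le_left : U ⊓ I ≤ U) 1
      (reduceH1Pk W p k U y) = 0) :
    resLe (tateRep W p).toTopRep (inf_le_left : U ⊓ I ≤ U) 1 y = 0 := by
  refine eq_zero_of_forall_reduceH1Pk_eq_zero W p _ _ fun k ↦ ?_
  rw [reduceH1Pk_resLe]
  exact hy k

end SignedLowerOffTwo.PTDeep

end Summit.BirchSwinnertonDyer.BirchSwinnertonDyer.Theorems

end
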